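import Mathlib
import Literature.Barriers.HubbardSuperconductivity.WeakCouplingCeiling

/-!
# Stub `stub_cutoffKernelBound` (line `Sketch`, crux `SignCone.OscCoherentCore`)

Fourier bound for the cut-off defect kernel `L(u) = (2cosh(δu) - 2) · χ_a(u)`,
`χ_a(u) = (1 - x³)³`, `x = min 1 (max 0 (|u| - 2a))`:
`|L̂(η)| ≤ δ² · 200 (2a+1)³ cosh(a + 1/2) / (1 + η²)` for `a ≥ 1`, `|δ| ≤ 1/2`.

Proof: `|L̂| ≤ ‖L‖₁`; splitting `[-2a-1, 2a+1]` at the knots `±2a` into three pieces on which `L` is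
smooth, two integrations by parts (boundary terms telescope: `L ∈ C¹`, `L = L' = 0` at `±(2a+1)`)
give `η² |L̂| ≤ Σ ‖L''‖₁`. The elementary `sinh y ≤ y cosh y` (`y ≥ 0`) is
`Literature.Barriers.HubbardSuperconductivity.sinh_le_self_mul_cosh`.
-/

noncomputable section

-- `Summit.RiemannHypothesis.RiemannHypothesis.…` repeats a namespace component by design (D-0017 layout).
set_option linter.dupNamespace false

open Complex MeasureTheory Set Filter
open scoped BigOperators Real

namespace Summit.RiemannHypothesis.RiemannHypothesis.Theorems.OscCoherentCore

open Literature.Barriers.HubbardSuperconductivity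

/-- `0 ≤ 2cosh b - 2 ≤ b² cosh b` (from `cosh b - 1 = 2 sinh²(b/2)` and `|sinh z| ≤ |z| cosh z`).
[folklore] -/
theorem cutoff_two_cosh_sub_two (b : ℝ) :
    0 ≤ 2 * Real.cosh b - 2 ∧ 2 * Real.cosh b - 2 ≤ b ^ 2 * Real.cosh b := by
  refine ⟨by linarith [Real.one_le_cosh b], ?_⟩
  have h1 : Real.cosh b = Real.cosh (b / 2) ^ 2 + Real.sinh (b / 2) ^ 2 := by
    rw [← Real.cosh_two_mul]; congr 1; ring
  have h2 : Real.cosh (b / 2) ^ 2 = 1 + Real.sinh (b / 2) ^ 2 := Real.cosh_sq' _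
  have h3 : |Real.sinh (b / 2)| ≤ |b / 2| * Real.cosh (b / 2) := by
    rw [Real.abs_sinh, ← Real.cosh_abs]; exact sinh_le_self_mul_cosh (abs_nonneg _)
  have h4 : Real.sinh (b / 2) ^ 2 ≤ (b / 2) ^ 2 * Real.cosh (b / 2) ^ 2 := by
    have := pow_le_pow_left₀ (abs_nonneg _) h3 2
    rwa [sq_abs, mul_pow, sq_abs] at this
  have h5 : Real.cosh (b / 2) ^ 2 ≤ Real.cosh b := by
    rw [h1]; nlinarith [sq_nonneg (Real.sinh (b / 2))]
  nlinarith [sq_nonneg b, h4, h5]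

/-- `‖∫_p^q g(u) e^{iηu} du‖ ≤ M |q - p|` when `|g| ≤ M` on `[[p, q]]`. [folklore] -/
theorem cutoff_norm_integral_mul_cexp_le {g : ℝ → ℝ} {p q M : ℝ} (η : ℝ)
    (hM : ∀ u ∈ uIcc p q, |g u| ≤ M) :
    ‖∫ u in p..q, (g u : ℂ) * cexp (↑(η * u) * I)‖ ≤ M * |q - p| :=
  intervalIntegral.norm_integral_le_of_norm_le_const fun u hu => by
    rw [norm_mul, Complex.norm_exp_ofReal_mul_I, mul_one, Complex.norm_real, Real.norm_eq_abs]
    exact hM u (uIoc_subset_uIcc hu)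

/-- Double integration by parts against `e^{iηu}`, in primitive form: for `f ∈ C²` with
`f'`, `f''` its derivatives, `∫_p^q (η² f + f'') e^{iηu} = [(f' - iηf) e^{iηu}]_p^q`. [folklore] -/
theorem cutoff_ibp_twice {f f' f'' : ℝ → ℝ} (hf : ∀ u, HasDerivAt f (f' u) u)
    (hf' : ∀ u, HasDerivAt f' (f'' u) u) (hf'' : Continuous f'') (η p q : ℝ) :
    (η ^ 2 : ℂ) * (∫ u in p..q, (f u : ℂ) * cexp (↑(η * u) * I)) +
        ∫ u in p..q, (f'' u : ℂ) * cexp (↑(η * u) * I) =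
      ((f' q : ℂ) - I * η * f q) * cexp (↑(η * q) * I) -
        ((f' p : ℂ) - I * η * f p) * cexp (↑(η * p) * I) := by
  have hfc : Continuous f := continuous_iff_continuousAt.2 fun u => (hf u).continuousAt
  have key : ∀ u, HasDerivAt (fun u => ((f' u : ℂ) - I * η * f u) * cexp (↑(η * u) * I))
      ((η ^ 2 : ℂ) * ((f u : ℂ) * cexp (↑(η * u) * I)) + (f'' u : ℂ) * cexp (↑(η * u) * I)) u := by
    intro u
    have h1 : HasDerivAt (fun u : ℝ => (↑(η * u) : ℂ) * I) (η * I) u := by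
      simpa using ((hasDerivAt_id u).const_mul η).ofReal_comp.mul_const I
    have he := h1.cexp
    have hA : HasDerivAt (fun u => (f' u : ℂ) - I * η * f u) ((f'' u : ℂ) - I * η * f' u) u :=
      (hf' u).ofReal_comp.sub ((hf u).ofReal_comp.const_mul (I * η))
    refine (hA.mul he).congr_deriv ?_
    linear_combination (-(η : ℂ) ^ 2 * (f u : ℂ) * cexp (↑(η * u) * I)) * Complex.I_mul_I
  rw [← intervalIntegral.integral_const_mul, ← intervalIntegral.integral_add]
  · exact intervalIntegral.integral_eq_sub_of_hasDerivAt (fun u _ => key u)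
      ((by fun_prop : Continuous _).intervalIntegrable _ _)
  · exact (by fun_prop : Continuous _).intervalIntegrable _ _
  · exact (by fun_prop : Continuous _).intervalIntegrable _ _

/-- `K' = 2δ sinh(δu)`. [folklore] -/
theorem cutoff_hasDerivAt_K (δ u : ℝ) :
    HasDerivAt (fun u => 2 * Real.cosh (δ * u) - 2) (2 * δ * Real.sinh (δ * u)) u := by
  refine ((((hasDerivAt_id' u).const_mul δ).cosh.const_mul 2).sub_const 2).congr_deriv ?_
  ring

/-- `K'' = 2δ² cosh(δu)`. [folklore] -/
theorem cutoff_hasDerivAt_K' (δ u : ℝ) :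
    HasDerivAt (fun u => 2 * δ * Real.sinh (δ * u)) (2 * δ ^ 2 * Real.cosh (δ * u)) u := by
  refine (((hasDerivAt_id' u).const_mul δ).sinh.const_mul (2 * δ)).congr_deriv ?_
  ring

/-- Derivative of the taper branch `u ↦ (1 - x³)³`, `x = σu - 2a`. [folklore] -/
theorem cutoff_hasDerivAt_P (a σ u : ℝ) :
    HasDerivAt (fun u => (1 - (σ * u - 2 * a) ^ 3) ^ 3)
      (-9 * (σ * u - 2 * a) ^ 2 * (1 - (σ * u - 2 * a) ^ 3) ^ 2 * σ) u := by
  have hx : HasDerivAt (fun u => σ * u - 2 * a) σ u := by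
    simpa using ((hasDerivAt_id' u).const_mul σ).sub_const (2 * a)
  refine (((hx.fun_pow 3).const_sub 1).fun_pow 3).congr_deriv ?_
  norm_num
  ring

/-- Second derivative of the taper branch. [folklore] -/
theorem cutoff_hasDerivAt_dP (a σ u : ℝ) :
    HasDerivAt (fun u => -9 * (σ * u - 2 * a) ^ 2 * (1 - (σ * u - 2 * a) ^ 3) ^ 2 * σ)
      ((-18 * (σ * u - 2 * a) * (1 - (σ * u - 2 * a) ^ 3) ^ 2 +
        54 * (σ * u - 2 * a) ^ 4 * (1 - (σ * u - 2 * a) ^ 3)) * σ ^ 2) u := by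
  have hx : HasDerivAt (fun u => σ * u - 2 * a) σ u := by
    simpa using ((hasDerivAt_id' u).const_mul σ).sub_const (2 * a)
  refine ((((hx.fun_pow 2).const_mul (-9)).mul (((hx.fun_pow 3).const_sub 1).fun_pow 2)).mul_const
    σ).congr_deriv ?_
  norm_num
  ring

/-- First derivative of `T(u) = K(u) · (1 - x³)³`, `x = σu - 2a`. [folklore] -/
theorem cutoff_hasDerivAt_T (δ a σ u : ℝ) :
    HasDerivAt (fun u => (2 * Real.cosh (δ * u) - 2) * (1 - (σ * u - 2 * a) ^ 3) ^ 3)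
      (2 * δ * Real.sinh (δ * u) * (1 - (σ * u - 2 * a) ^ 3) ^ 3 +
        (2 * Real.cosh (δ * u) - 2) *
          (-9 * (σ * u - 2 * a) ^ 2 * (1 - (σ * u - 2 * a) ^ 3) ^ 2 * σ)) u :=
  (cutoff_hasDerivAt_K δ u).mul (cutoff_hasDerivAt_P a σ u)

/-- Second derivative of `T`: `T'' = K''P + 2K'P' + KP''`. [folklore] -/
theorem cutoff_hasDerivAt_T' (δ a σ u : ℝ) :
    HasDerivAt (fun u => 2 * δ * Real.sinh (δ * u) * (1 - (σ * u - 2 * a) ^ 3) ^ 3 +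
        (2 * Real.cosh (δ * u) - 2) *
          (-9 * (σ * u - 2 * a) ^ 2 * (1 - (σ * u - 2 * a) ^ 3) ^ 2 * σ))
      (2 * δ ^ 2 * Real.cosh (δ * u) * (1 - (σ * u - 2 * a) ^ 3) ^ 3 +
        2 * (2 * δ * Real.sinh (δ * u)) *
          (-9 * (σ * u - 2 * a) ^ 2 * (1 - (σ * u - 2 * a) ^ 3) ^ 2 * σ) +
        (2 * Real.cosh (δ * u) - 2) *
          ((-18 * (σ * u - 2 * a) * (1 - (σ * u - 2 * a) ^ 3) ^ 2 +
            54 * (σ * u - 2 * a) ^ 4 * (1 - (σ * u - 2 * a) ^ 3)) * σ ^ 2)) u := by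
  refine (((cutoff_hasDerivAt_K' δ u).mul (cutoff_hasDerivAt_P a σ u)).add
    ((cutoff_hasDerivAt_K δ u).mul (cutoff_hasDerivAt_dP a σ u))).congr_deriv ?_
  ring

/-- On `|u| ≤ 2a + 1`, `|δ| ≤ 1/2`: `cosh(δu) ≤ cosh(a + 1/2)`, `0 ≤ K ≤ δ²(2a+1)² cosh(a+1/2)`,
`|K'| ≤ 2δ²(2a+1) cosh(a+1/2)`, `0 ≤ K'' ≤ 2δ² cosh(a+1/2)`. [folklore] -/
theorem cutoff_K_bounds {δ a u : ℝ} (ha : 1 ≤ a) (hδ : |δ| ≤ 1 / 2) (hu : |u| ≤ 2 * a + 1) :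
    Real.cosh (δ * u) ≤ Real.cosh (a + 1 / 2) ∧
    (0 ≤ 2 * Real.cosh (δ * u) - 2 ∧
      2 * Real.cosh (δ * u) - 2 ≤ δ ^ 2 * (2 * a + 1) ^ 2 * Real.cosh (a + 1 / 2)) ∧
    |2 * δ * Real.sinh (δ * u)| ≤ 2 * δ ^ 2 * (2 * a + 1) * Real.cosh (a + 1 / 2) ∧
    (0 ≤ 2 * δ ^ 2 * Real.cosh (δ * u) ∧
      2 * δ ^ 2 * Real.cosh (δ * u) ≤ 2 * δ ^ 2 * Real.cosh (a + 1 / 2)) := by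
  have hc0 : 0 < Real.cosh (δ * u) := Real.cosh_pos _
  have hC : Real.cosh (δ * u) ≤ Real.cosh (a + 1 / 2) := by
    rw [Real.cosh_le_cosh, abs_mul]
    calc |δ| * |u| ≤ 1 / 2 * (2 * a + 1) := mul_le_mul hδ hu (abs_nonneg _) (by norm_num)
      _ = a + 1 / 2 := by ring
      _ ≤ |a + 1 / 2| := le_abs_self _
  obtain ⟨hK0, hK⟩ := cutoff_two_cosh_sub_two (δ * u)
  have hu2 : u ^ 2 ≤ (2 * a + 1) ^ 2 := by
    rw [← sq_abs u]; exact pow_le_pow_left₀ (abs_nonneg u) hu 2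
  have huC : u ^ 2 * Real.cosh (δ * u) ≤ (2 * a + 1) ^ 2 * Real.cosh (a + 1 / 2) :=
    mul_le_mul hu2 hC hc0.le (sq_nonneg _)
  have huC' : |u| * Real.cosh (δ * u) ≤ (2 * a + 1) * Real.cosh (a + 1 / 2) :=
    mul_le_mul hu hC hc0.le (by linarith)
  have hs : |Real.sinh (δ * u)| ≤ |δ * u| * Real.cosh (δ * u) := by
    rw [Real.abs_sinh, ← Real.cosh_abs]; exact sinh_le_self_mul_cosh (abs_nonneg _)
  rw [abs_mul] at hs
  refine ⟨hC, ⟨hK0, ?_⟩, ?_, ⟨by positivity, ?_⟩⟩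
  · calc 2 * Real.cosh (δ * u) - 2 ≤ (δ * u) ^ 2 * Real.cosh (δ * u) := hK
      _ = δ ^ 2 * (u ^ 2 * Real.cosh (δ * u)) := by ring
      _ ≤ δ ^ 2 * ((2 * a + 1) ^ 2 * Real.cosh (a + 1 / 2)) :=
          mul_le_mul_of_nonneg_left huC (sq_nonneg _)
      _ = δ ^ 2 * (2 * a + 1) ^ 2 * Real.cosh (a + 1 / 2) := by ring
  · calc |2 * δ * Real.sinh (δ * u)| = 2 * |δ| * |Real.sinh (δ * u)| := by
          rw [abs_mul, abs_mul, abs_two]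
      _ ≤ 2 * |δ| * (|δ| * |u| * Real.cosh (δ * u)) := by gcongr
      _ = 2 * |δ| ^ 2 * (|u| * Real.cosh (δ * u)) := by ring
      _ ≤ 2 * |δ| ^ 2 * ((2 * a + 1) * Real.cosh (a + 1 / 2)) :=
          mul_le_mul_of_nonneg_left huC' (by positivity)
      _ = 2 * δ ^ 2 * (2 * a + 1) * Real.cosh (a + 1 / 2) := by rw [sq_abs]; ring
  · exact mul_le_mul_of_nonneg_left hC (by positivity)

/-- On `0 ≤ x ≤ 1`, `|σ| = 1`: `|(1-x³)³| ≤ 1`, `|P'| ≤ 9`, `|P''| ≤ 72`. [folklore] -/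
theorem cutoff_poly_bounds {x σ : ℝ} (hσ : |σ| = 1) (hx0 : 0 ≤ x) (hx1 : x ≤ 1) :
    |(1 - x ^ 3) ^ 3| ≤ 1 ∧ |-9 * x ^ 2 * (1 - x ^ 3) ^ 2 * σ| ≤ 9 ∧
      |(-18 * x * (1 - x ^ 3) ^ 2 + 54 * x ^ 4 * (1 - x ^ 3)) * σ ^ 2| ≤ 72 := by
  have hx3 : x ^ 3 ≤ 1 := pow_le_one₀ hx0 hx1
  have hx3' : 0 ≤ x ^ 3 := pow_nonneg hx0 3
  have hy0 : 0 ≤ 1 - x ^ 3 := by linarith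
  have hy1 : 1 - x ^ 3 ≤ 1 := by linarith
  have hσ2 : σ ^ 2 = 1 := by rw [← sq_abs, hσ, one_pow]
  refine ⟨?_, ?_, ?_⟩
  · rw [abs_of_nonneg (pow_nonneg hy0 3)]; exact pow_le_one₀ hy0 hy1
  · rw [abs_mul, hσ, mul_one]
    have h1 : x ^ 2 * (1 - x ^ 3) ^ 2 ≤ 1 :=
      mul_le_one₀ (pow_le_one₀ hx0 hx1) (sq_nonneg _) (pow_le_one₀ hy0 hy1)
    rw [show -9 * x ^ 2 * (1 - x ^ 3) ^ 2 = -(9 * (x ^ 2 * (1 - x ^ 3) ^ 2)) by ring, abs_neg,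
      abs_of_nonneg (by positivity)]
    linarith
  · rw [hσ2, mul_one]
    have h1 : x * (1 - x ^ 3) ^ 2 ≤ 1 := mul_le_one₀ hx1 (sq_nonneg _) (pow_le_one₀ hy0 hy1)
    have h1' : 0 ≤ x * (1 - x ^ 3) ^ 2 := mul_nonneg hx0 (sq_nonneg _)
    have h2 : x ^ 4 * (1 - x ^ 3) ≤ 1 := mul_le_one₀ (pow_le_one₀ hx0 hx1) hy0 hy1
    have h2' : 0 ≤ x ^ 4 * (1 - x ^ 3) := mul_nonneg (pow_nonneg hx0 4) hy0
    rw [abs_le]; constructor <;> nlinarith [h1, h1', h2, h2']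

/-- `0 ≤ χ_a ≤ 1`: `|(1 - m³)³| ≤ 1` for `m = min 1 (max 0 (|u| - 2a)) ∈ [0, 1]`. [folklore] -/
theorem cutoff_abs_chi_le_one (a u : ℝ) : |(1 - (min 1 (max 0 (|u| - 2 * a))) ^ 3) ^ 3| ≤ 1 := by
  have hm0 : 0 ≤ min 1 (max 0 (|u| - 2 * a)) := le_min zero_le_one (le_max_left _ _)
  have hm1 : min 1 (max 0 (|u| - 2 * a)) ≤ 1 := min_le_left _ _
  have h0 : 0 ≤ 1 - (min 1 (max 0 (|u| - 2 * a))) ^ 3 := sub_nonneg.2 (pow_le_one₀ hm0 hm1)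
  have h1 : 1 - (min 1 (max 0 (|u| - 2 * a))) ^ 3 ≤ 1 := by linarith [pow_nonneg hm0 3]
  rw [abs_of_nonneg (pow_nonneg h0 3)]
  exact pow_le_one₀ h0 h1

/-- Sup bound for `T''` on the taper: `|T''| ≤ δ² cosh(a+1/2) (2 + 36R + 72R²)`, `R = 2a+1`.
[folklore] -/
theorem cutoff_abs_T''_le {δ a σ u : ℝ} (ha : 1 ≤ a) (hσ : |σ| = 1) (hδ : |δ| ≤ 1 / 2)
    (hu : |u| ≤ 2 * a + 1) (hx0 : 0 ≤ σ * u - 2 * a) (hx1 : σ * u - 2 * a ≤ 1) :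
    |2 * δ ^ 2 * Real.cosh (δ * u) * (1 - (σ * u - 2 * a) ^ 3) ^ 3 +
        2 * (2 * δ * Real.sinh (δ * u)) *
          (-9 * (σ * u - 2 * a) ^ 2 * (1 - (σ * u - 2 * a) ^ 3) ^ 2 * σ) +
        (2 * Real.cosh (δ * u) - 2) *
          ((-18 * (σ * u - 2 * a) * (1 - (σ * u - 2 * a) ^ 3) ^ 2 +
            54 * (σ * u - 2 * a) ^ 4 * (1 - (σ * u - 2 * a) ^ 3)) * σ ^ 2)| ≤
      δ ^ 2 * Real.cosh (a + 1 / 2) * (2 + 36 * (2 * a + 1) + 72 * (2 * a + 1) ^ 2) := by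
  obtain ⟨-, ⟨hK0, hK⟩, hK', ⟨hK''0, hK''⟩⟩ := cutoff_K_bounds ha hδ hu
  obtain ⟨hP, hdP, hddP⟩ := cutoff_poly_bounds hσ hx0 hx1
  have hC0 : 0 < Real.cosh (a + 1 / 2) := Real.cosh_pos _
  have hR0 : 0 ≤ 2 * a + 1 := by linarith
  have i1 : |2 * δ ^ 2 * Real.cosh (δ * u) * (1 - (σ * u - 2 * a) ^ 3) ^ 3| ≤
      2 * δ ^ 2 * Real.cosh (a + 1 / 2) * 1 := by
    rw [abs_mul, abs_of_nonneg hK''0]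
    exact mul_le_mul hK'' hP (abs_nonneg _) (by positivity)
  have i2 : |2 * (2 * δ * Real.sinh (δ * u)) *
      (-9 * (σ * u - 2 * a) ^ 2 * (1 - (σ * u - 2 * a) ^ 3) ^ 2 * σ)| ≤
      2 * (2 * δ ^ 2 * (2 * a + 1) * Real.cosh (a + 1 / 2)) * 9 := by
    rw [abs_mul, abs_mul, abs_two]
    refine mul_le_mul (mul_le_mul_of_nonneg_left hK' zero_le_two) hdP (abs_nonneg _) ?_
    exact mul_nonneg zero_le_two (mul_nonneg (mul_nonneg (by positivity) hR0) hC0.le)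
  have i3 : |(2 * Real.cosh (δ * u) - 2) *
      ((-18 * (σ * u - 2 * a) * (1 - (σ * u - 2 * a) ^ 3) ^ 2 +
        54 * (σ * u - 2 * a) ^ 4 * (1 - (σ * u - 2 * a) ^ 3)) * σ ^ 2)| ≤
      δ ^ 2 * (2 * a + 1) ^ 2 * Real.cosh (a + 1 / 2) * 72 := by
    rw [abs_mul, abs_of_nonneg hK0]
    exact mul_le_mul hK hddP (abs_nonneg _) (by positivity)
  refine (abs_add_three _ _ _).trans ?_
  nlinarith [i1, i2, i3]

/-- Middle piece `[-2a, 2a]` (where `χ_a = 1`): `η² ∫ K e^{iηu} + J = [Φ_K]_{-2a}^{2a}` with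
`‖J‖ ≤ 2δ² cosh(a+1/2) · 4a`. [folklore] -/
theorem cutoff_middle_package (δ a η : ℝ) (ha : 1 ≤ a) (hδ : |δ| ≤ 1 / 2) :
    ∃ J : ℂ, ‖J‖ ≤ 2 * δ ^ 2 * Real.cosh (a + 1 / 2) * |2 * a - -(2 * a)| ∧
      (η ^ 2 : ℂ) * (∫ u in -(2 * a)..2 * a, ((2 * Real.cosh (δ * u) - 2 : ℝ) : ℂ) *
          cexp (↑(η * u) * I)) + J =
        ((↑(2 * δ * Real.sinh (δ * (2 * a))) : ℂ) - I * η * ↑(2 * Real.cosh (δ * (2 * a)) - 2)) *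
            cexp (↑(η * (2 * a)) * I) -
          ((↑(2 * δ * Real.sinh (δ * -(2 * a))) : ℂ) - I * η * ↑(2 * Real.cosh (δ * -(2 * a)) - 2)) *
            cexp (↑(η * -(2 * a)) * I) := by
  refine ⟨_, ?_, cutoff_ibp_twice (cutoff_hasDerivAt_K δ) (cutoff_hasDerivAt_K' δ) (by fun_prop) η
    (-(2 * a)) (2 * a)⟩
  refine cutoff_norm_integral_mul_cexp_le η fun u hu => ?_
  rw [uIcc_of_le (by linarith)] at hu
  have hu' : |u| ≤ 2 * a + 1 := abs_le.2 ⟨by linarith [hu.1], by linarith [hu.2]⟩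
  obtain ⟨-, -, -, h0, h1⟩ := cutoff_K_bounds ha hδ hu'
  rw [abs_of_nonneg h0]
  exact h1

/-- Taper piece between the knots `p` (`σp - 2a = 0`) and `q` (`σq - 2a = 1`), `σ = ±1`:
`η² ∫_p^q T e^{iηu} + J = -Φ_K(p)` with `‖J‖ ≤ δ² cosh(a+1/2) (2 + 36R + 72R²) |q - p|`. [folklore] -/
theorem cutoff_taper_package (δ a σ η p q : ℝ) (ha : 1 ≤ a) (hδ : |δ| ≤ 1 / 2) (hσ : |σ| = 1)
    (hp : σ * p - 2 * a = 0) (hq : σ * q - 2 * a = 1) :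
    ∃ J : ℂ, ‖J‖ ≤ δ ^ 2 * Real.cosh (a + 1 / 2) * (2 + 36 * (2 * a + 1) + 72 * (2 * a + 1) ^ 2) *
        |q - p| ∧
      (η ^ 2 : ℂ) * (∫ u in p..q, (((2 * Real.cosh (δ * u) - 2) * (1 - (σ * u - 2 * a) ^ 3) ^ 3 : ℝ) : ℂ) *
          cexp (↑(η * u) * I)) + J =
        -(((↑(2 * δ * Real.sinh (δ * p)) : ℂ) - I * η * ↑(2 * Real.cosh (δ * p) - 2)) *
          cexp (↑(η * p) * I)) := by
  refine ⟨_, ?_, (cutoff_ibp_twice (cutoff_hasDerivAt_T δ a σ) (cutoff_hasDerivAt_T' δ a σ)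
    (by fun_prop) η p q).trans ?_⟩
  · refine cutoff_norm_integral_mul_cexp_le η fun u hu => ?_
    obtain ⟨hu1, hx0, hx1⟩ : |u| ≤ 2 * a + 1 ∧ 0 ≤ σ * u - 2 * a ∧ σ * u - 2 * a ≤ 1 := by
      rcases (abs_eq zero_le_one).1 hσ with rfl | rfl
      · rw [uIcc_of_le (by linarith)] at hu
        exact ⟨abs_le.2 ⟨by linarith [hu.1], by linarith [hu.2]⟩, by linarith [hu.1],
          by linarith [hu.2]⟩
      · rw [uIcc_of_ge (by linarith)] at hu
        exact ⟨abs_le.2 ⟨by linarith [hu.1], by linarith [hu.2]⟩, by linarith [hu.2],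
          by linarith [hu.1]⟩
    exact cutoff_abs_T''_le ha hσ hδ hu1 hx0 hx1
  · simp only [hp, hq]
    push_cast
    ring

/-- STUB C (Fourier bound for the cut-off defect kernel). For `a ≥ 1`, `|δ| ≤ 1/2` and every real `η`,
`|L̂_{a,δ}(η)| ≤ δ² · 200 (2a+1)³ cosh(a + 1/2) / (1 + η²)`: `L = K_δ χ_a` is `C²`, supported in `|u| ≤ 2a + 1`,
with `|K_δ| ≤ δ²u² cosh(δu)`, `|K_δ'| ≤ 2δ²|u| cosh(δu)`, `|K_δ''| ≤ 2δ² cosh(δu)`; `|L̂| ≤ ‖L‖₁` and, after two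
integrations by parts on each of the three smooth pieces (boundary terms telescope), `η² |L̂| ≤ ‖L''‖₁`. [folklore] -/
theorem stub_cutoffKernelBound :
    ∀ a : ℝ, 1 ≤ a → ∀ δ : ℝ, |δ| ≤ 1 / 2 → ∀ η : ℝ,
      ‖∫ u : ℝ, (((2 * Real.cosh (δ * u) - 2) * (1 - (min 1 (max 0 (|u| - 2 * a))) ^ 3) ^ 3 : ℝ) : ℂ) *
          cexp (↑(η * u) * I)‖ ≤
        δ ^ 2 * (200 * (2 * a + 1) ^ 3 * Real.cosh (a + 1 / 2)) / (1 + η ^ 2) := by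
  intro a ha δ hδ η
  set F : ℝ → ℂ := fun u => (((2 * Real.cosh (δ * u) - 2) *
    (1 - (min 1 (max 0 (|u| - 2 * a))) ^ 3) ^ 3 : ℝ) : ℂ) * cexp (↑(η * u) * I) with hFdef
  have hFc : Continuous F := by rw [hFdef]; fun_prop
  -- `F` vanishes off `[-(2a+1), 2a+1]`
  have hzero : ∀ u : ℝ, 2 * a + 1 ≤ |u| → F u = 0 := by
    intro u hu
    have hx : min 1 (max 0 (|u| - 2 * a)) = 1 := min_eq_left (le_max_of_le_right (by linarith))
    simp only [hFdef, hx]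
    norm_num
  have hsupp : (∫ u, F u) = ∫ u in -(2 * a + 1)..(2 * a + 1), F u := by
    refine (intervalIntegral.integral_eq_integral_of_support_subset fun u hu => ?_).symm
    by_contra hnot
    refine hu (hzero u ?_)
    rw [mem_Ioc, not_and_or, not_lt, not_le] at hnot
    rcases hnot with h | h
    · linarith [neg_le_abs u]
    · linarith [le_abs_self u]
  -- the `L¹` bound
  have hB0 : ‖∫ u, F u‖ ≤ δ ^ 2 * (2 * a + 1) ^ 2 * Real.cosh (a + 1 / 2) *
      |(2 * a + 1) - -(2 * a + 1)| := by
    rw [hsupp]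
    refine cutoff_norm_integral_mul_cexp_le η fun u hu => ?_
    rw [uIcc_of_le (by linarith)] at hu
    have hu' : |u| ≤ 2 * a + 1 := abs_le.2 ⟨hu.1, hu.2⟩
    obtain ⟨-, ⟨h0, h1⟩, -⟩ := cutoff_K_bounds ha hδ hu'
    rw [abs_mul, abs_of_nonneg h0]
    simpa using mul_le_mul h1 (cutoff_abs_chi_le_one a u) (abs_nonneg _) (by positivity)
  -- splitting at the knots
  have hsplit : (∫ u in -(2 * a + 1)..-(2 * a), F u) + ((∫ u in -(2 * a)..2 * a, F u) +
      ∫ u in (2 * a)..(2 * a + 1), F u) = ∫ u in -(2 * a + 1)..(2 * a + 1), F u := by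
    rw [intervalIntegral.integral_add_adjacent_intervals (hFc.intervalIntegrable _ _)
      (hFc.intervalIntegrable _ _), intervalIntegral.integral_add_adjacent_intervals
      (hFc.intervalIntegrable _ _) (hFc.intervalIntegrable _ _)]
  have hc1 : ∫ u in -(2 * a)..2 * a, F u =
      ∫ u in -(2 * a)..2 * a, ((2 * Real.cosh (δ * u) - 2 : ℝ) : ℂ) * cexp (↑(η * u) * I) := by
    refine intervalIntegral.integral_congr fun u hu => ?_
    rw [uIcc_of_le (by linarith)] at hu
    have hx : min 1 (max 0 (|u| - 2 * a)) = 0 := by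
      rw [max_eq_left (by linarith [abs_le.2 ⟨hu.1, hu.2⟩]), min_eq_right zero_le_one]
    simp only [hFdef, hx]
    norm_num
  have hc2 : ∫ u in (2 * a)..(2 * a + 1), F u = ∫ u in (2 * a)..(2 * a + 1),
      (((2 * Real.cosh (δ * u) - 2) * (1 - (1 * u - 2 * a) ^ 3) ^ 3 : ℝ) : ℂ) * cexp (↑(η * u) * I) := by
    refine intervalIntegral.integral_congr fun u hu => ?_
    rw [uIcc_of_le (by linarith)] at hu
    have hx : min 1 (max 0 (|u| - 2 * a)) = 1 * u - 2 * a := by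
      rw [abs_of_nonneg (by linarith [hu.1]), max_eq_right (by linarith [hu.1]),
        min_eq_right (by linarith [hu.2]), one_mul]
    simp only [hFdef, hx]
  have hc3 : ∫ u in -(2 * a + 1)..-(2 * a), F u = ∫ u in -(2 * a + 1)..-(2 * a),
      (((2 * Real.cosh (δ * u) - 2) * (1 - (-1 * u - 2 * a) ^ 3) ^ 3 : ℝ) : ℂ) * cexp (↑(η * u) * I) := by
    refine intervalIntegral.integral_congr fun u hu => ?_
    rw [uIcc_of_le (by linarith)] at hu
    have hx : min 1 (max 0 (|u| - 2 * a)) = -1 * u - 2 * a := by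
      rw [abs_of_nonpos (by linarith [hu.2]), max_eq_right (by linarith [hu.2]),
        min_eq_right (by linarith [hu.1]), neg_one_mul]
    simp only [hFdef, hx]
  -- two integrations by parts on each piece
  obtain ⟨J1, hJ1, h1⟩ := cutoff_middle_package δ a η ha hδ
  obtain ⟨J2, hJ2, h2⟩ := cutoff_taper_package δ a 1 η (2 * a) (2 * a + 1) ha hδ abs_one
    (by ring) (by ring)
  obtain ⟨J3, hJ3, h3⟩ := cutoff_taper_package δ a (-1) η (-(2 * a)) (-(2 * a + 1)) ha hδ
    (by rw [abs_neg, abs_one]) (by ring) (by ring)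
  rw [intervalIntegral.integral_symm (-(2 * a + 1)) (-(2 * a))] at h3
  have hid : (η ^ 2 : ℂ) * (∫ u, F u) = -J1 - J2 + J3 := by
    rw [hsupp, ← hsplit, hc1, hc2, hc3]
    linear_combination h1 + h2 - h3
  -- norms
  have hη : η ^ 2 * ‖∫ u, F u‖ ≤ ‖J1‖ + ‖J2‖ + ‖J3‖ := by
    have e : ‖(η ^ 2 : ℂ) * ∫ u, F u‖ = η ^ 2 * ‖∫ u, F u‖ := by
      rw [norm_mul, norm_pow, Complex.norm_real, Real.norm_eq_abs, sq_abs]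
    rw [← e, hid, show -J1 - J2 + J3 = -J1 + -J2 + J3 by ring]
    exact norm_add₃_le.trans (by rw [norm_neg, norm_neg])
  rw [show (2 * a + 1) - -(2 * a + 1) = 2 * (2 * a + 1) by ring,
    abs_of_nonneg (by linarith)] at hB0
  rw [show 2 * a - -(2 * a) = 4 * a by ring, abs_of_nonneg (by linarith)] at hJ1
  rw [show 2 * a + 1 - 2 * a = (1 : ℝ) by ring, abs_one, mul_one] at hJ2
  rw [show -(2 * a + 1) - -(2 * a) = (-1 : ℝ) by ring, abs_neg, abs_one, mul_one] at hJ3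
  have hfin := mul_le_mul_of_nonneg_left (show 2 * (2 * a + 1) ^ 3 + 76 * (2 * a + 1) +
    144 * (2 * a + 1) ^ 2 ≤ 200 * (2 * a + 1) ^ 3 by nlinarith)
    (mul_nonneg (sq_nonneg δ) (Real.cosh_pos (a + 1 / 2)).le)
  rw [le_div_iff₀ (by positivity)]
  calc ‖∫ u, F u‖ * (1 + η ^ 2) = ‖∫ u, F u‖ + η ^ 2 * ‖∫ u, F u‖ := by ring
    _ ≤ _ := add_le_add hB0 hη
    _ ≤ _ := by linarith

end Summit.RiemannHypothesis.RiemannHypothesis.Theorems.OscCoherentCore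

end
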